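import Summits.QuantumFields.BalabanUV.Beta.GAN24.CurrentSymTower
import Summits.QuantumFields.BalabanUV.Beta.GAN24.SymCorrectorClassCurrent
import Summits.QuantumFields.BalabanUV.Beta.GAN24.CombTransportParity
import Summits.QuantumFields.BalabanUV.Beta.GAN24.SlotTransportParity
import Summits.QuantumFields.BalabanUV.Beta.GAN24.CombEvenTowerAutonomy
import Summits.QuantumFields.BalabanUV.Beta.GAN24.CombCubicStepTransport
import Summits.QuantumFields.BalabanUV.Beta.GAN24.CombTransportZeroMode
import Summits.QuantumFields.BalabanUV.Beta.GAN24.VHWordsZeroBorder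

/-!
# `BalabanUV.Beta.GAN24.CombRespWordsZero` — binder row G-an2-4 ∕ (CONV-C), TRANSFER-III, the (III′) (C)-campaign's supplier `hB0` (memo M-1 §2 row `hB0`, VALUE side):
# **(L3c) AT THE COMB DATA — THE TWO OUTER-SUMMED SECOND-RESPONSE WORDS OF THE COMB FORCING's ff CELL CHARGE CANCEL AT EVERY LEVEL**, because the `𝒯`-transported comb tables
# of an1's record are class-current symmetric with NO displayed hypothesis (leaf-01 g84's `sym_transport_SpureCombOf_an1S2`) and parity-odd (the parities of `symVhSAt ∕ symHessFFAt`
# through an2's slot-generic `trK_SpureRecOf`, leaf-01 g79's `parityOdd_slotPsiS`, road-P2's `parityOdd_conj_psiKS`)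
# (G-an2-4 CRUX TEAM (2), leaf prover `b2b-balaban-gan24-formalise-leaf-01`, gen 85; journal [LEAF01-G85-INTENT-4])

NOT IN PRINT; OUR BOOKKEEPING ([folklore]: leaf-04 g69's (L3c) `RespWordsAllLevels.respWords_add_swap_eq_zero` ∕ `respCharge_add_swap_eq_zero` ∕ (A)-tower junction
`faceSource_unitS_SpureRecAt_add_swap_eq_zero` COPIED TOKEN FOR TOKEN with the (E) table `unitS s_f s_m (SpureRecAt j)` replaced by the transported comb table
`T♮_j := unitS s_f s_m (𝒯 (SpureCombOf (symTablesAn1S2 d Lc cΛt) cE cVH cΛ j))` at the centre root (`ρ_c = ctr (d+1) Lc = toSite (ctrOff (d+1) Lc)`, `rfl`); the generic cell form 38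
`RespWordCellForm.tsum_respWord_eq_cell`, 39 `RespChargeSym.respCharge_eq ∕ abs_faceSource_le`, 37 `RespInnerBondKernel.decays_gaugeStencil`, `FaceDatumMultiplierResponse.sawtooth_step` BY NAME;
0 `def`, 0 cited fact, 0 `def … : Prop`, 0 sorry).
HONEST FRAMING (cell contract, verbatim): «discharging `BetaPertH` makes Bałaban's UV stability UNCONDITIONAL — a real constructive-QFT result; it is NOT the continuum limit and NOT
the Clay problem.»  HONEST DEPENDENCY (verbatim): «continuum YM on T⁴ ⇐ BetaPertH ∧ nine spine estimates (0/9 proved); BetaPertH ⇐ (D1) ∧ (D4) ∧ CAP+tail; G-an2-4 gates asym, D1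
and NE2/3/4.»

## What is proved (generic `d`; `Ψ̂_S = psiKS (ctrOff (d+1) Lc) Lc`, `𝒯S κ u := Ψ̂_Sᵀ ∘ slotPsiS S κ u ∘ Ψ̂_S`, `S′_j := SpureCombOf (symTablesAn1S2 d Lc cΛt) cE cVH cΛ j`, `T♮_j := unitS s_f s_m (𝒯 S′_j)`,
## `X̃_j := unitK s_f s_m (coDressKBmAt ρ_c Lc (KInvStep Lc j))` — leaf-01 g85's (Q1) `CombForcingTransport` puts the comb forcing's tables and kernel in exactly this shape)
* §1 sockets: `exists_locStencil_transportS`, `transportS_translate`, **`parityOdd_transportS`** (`trK (𝒯S′_j κ u) = −sgnK (𝒯S′_j κ u)`), and with units `exists_locStencil_unitS_transportS`,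
  `unitS_transportS_translate`, `parityOdd_unitS_transportS`.
* §2 **`faceSource_unitS_transportS_add_swap_eq_zero`** — the (A)-tower junction at the comb data: the `(μ ↔ ν)`-symmetrised exit-face source of `T♮_j` vanishes at EVERY first leg `(s, f)`.
* §3 **`respCharge_transportS_add_swap_eq_zero`** — the symmetrised column charges of the gauge-differentiated inverse `K2OfK X̃_j Lc T♮_j M` vanish, every row `(t, g)`.
* §4 **`respWords_transportS_add_swap_eq_zero`** — (L3c) AT THE COMB DATA: for ANY block-covariant multiplier vertex family `M`, every bond `c`, axes `(μ,ν;α,β)`: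
  `Σ'_{u′} FF[dM (K2OfK X̃_j Lc T♮_j M μ c) Lc T♮_j M ν u′] + Σ'_{u′} FF[dM (K2OfK X̃_j Lc T♮_j M ν c) Lc T♮_j M μ u′] = 0` — with `M := 𝒯′M̃′_j` these are the two response words of
  the third (`K·W·K`) two-face word of leaf-01 g85's `CombForcingTwoFaceWords.zmode_combForcing_inl_inl` after 32.
WHAT THIS IS NOT: 32 (`WWordRespSummable`: the `K·W·K` word = half the outer-summed response words + the mixed words) is NOT re-typed here; the `E ⊗ VH`, `VH ⊗ E`, `E ⊗ E` words are NOT touched;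
NO value of any table or charge; NOT `hB0`, NOT (d′)∕(d″); the (III′) campaign is NOT asked (an2 W-4); NEVER «G-an2-4 closed» as (CONV-C); NOT D1, NOT `BetaPertH`, NOT continuum, NOT Clay.
2026-08-27; no existing file touched.
-/

noncomputable section

open Finset
open scoped BigOperators
open Literature.MathematicalPhysics.QuantumFieldTheory
open Literature.MathematicalPhysics.QuantumFieldTheory.Balaban1983to89
open Literature.MathematicalPhysics.QuantumFieldTheory.Balaban1983to89.Beta
open B12Sec2to5 (l1 l1_nonneg)
open ExpKernelCalculus (Site MKer comp Decays BiLoc VertexFamily Zl Zl_nonneg shiftK summable_exp_shift)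
open AffineAveraging (box toSite)
open AveragingContoursRooted (ctr ctrOff ctrOff_mem_box)
open OneStepResolventKernel (Fib LocStencil decays_mono)
open OneStepKernelFamily (KInvStep decays_KInvStep)
open SecondOrderResponse (dM K2OfK)
open Summit.QuantumFields.BalabanUV.Beta.TameKernelCalculus (trK trK_apply Loc Spr)
open Summit.QuantumFields.BalabanUV.Beta.BorderedHessian (sgnK sgnK_apply sgnF sgnF_inl)
open Summit.QuantumFields.BalabanUV.Beta.HessKerDressedUnits (unitK unitS unitS_apply legScale legScale_inl decays_unitK locStencil_unitS)
open Summit.QuantumFields.BalabanUV.Beta.AxialDressingRooted (coDressKBmAt decays_coDressKBmAt)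
open Summit.QuantumFields.BalabanUV.Beta.SymmetrisedStepJets (SymTables)
open Summit.QuantumFields.BalabanUV.Beta.SymTablesAn1FirstOrder (trK_symVhSAt trK_symHessFFAt)
open Summit.QuantumFields.BalabanUV.Beta.SymSecondOrderTablesAn1 (symTablesAn1S2)
open Summit.QuantumFields.BalabanUV.Beta.CombChartStepJets (SpureCombOf locStencil_SpureCombOf SpureCombOf_translate)
open Summit.QuantumFields.BalabanUV.Beta.SymCorrectorKernel (psiKS spr_psiKS)
open Summit.QuantumFields.BalabanUV.Beta.SymCorrectorFace (slotPsiS slotPsiS_shift)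
open Summit.QuantumFields.BalabanUV.Beta.SymCorrectorSockets (locStencil_slotPsiS)
open Summit.QuantumFields.BalabanUV.Beta.GAN24.CombCubicStepTransport (locStencil_transportPsiS)
open Summit.QuantumFields.BalabanUV.Beta.GAN24.CombTransportZeroMode (conj_psiKS_shiftK)
open Summit.QuantumFields.BalabanUV.Beta.GAN24.CombEvenTowerAutonomy (trK_SpureCombOf)
open Summit.QuantumFields.BalabanUV.Beta.GAN24.SlotTransportParity (parityOdd_slotPsiS)
open Summit.QuantumFields.BalabanUV.Beta.GAN24.CombTransportParity (parityOdd_conj_psiKS)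
open Summit.QuantumFields.BalabanUV.Beta.GAN24.ExchangeSlotResum (face_weight_periodic)
open Summit.QuantumFields.BalabanUV.Beta.GAN24.VHWordsZeroBorder (unitS_translate_block)
open Summit.QuantumFields.BalabanUV.Beta.GAN24.RespWordCellForm (tsum_respWord_eq_cell)
open Summit.QuantumFields.BalabanUV.Beta.GAN24.RespChargeSym (respCharge_eq abs_faceSource_le)
open Summit.QuantumFields.BalabanUV.Beta.GAN24.CurrentSymSectorSplit (abs_classDatum_le)
open Summit.QuantumFields.BalabanUV.Beta.GAN24.RespWordsAllLevels (cell_pairing_add_swap_eq_zero')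
open Summit.QuantumFields.BalabanUV.Beta.GAN24.SymCorrectorClassCurrent (sym_transport_SpureCombOf_an1S2)

namespace Summit.QuantumFields.BalabanUV.Beta.GAN24.CombRespWordsZero

variable {d : ℕ} {Lc : ℕ} [NeZero Lc]

/-! ## §1 Sockets of the transported pure comb table at an1's record -/

/-- [folklore] `𝒯 S′_j` is a local stencil family (an2's `locStencil_SpureCombOf` ⨾ road-P2 M.43 `locStencil_transportPsiS`). -/
theorem exists_locStencil_transportS (cΛt cE cVH cΛ : ℝ) (j : ℕ) :
    ∃ Cs δs : ℝ, 0 < δs ∧ LocStencil (fun κ u => comp (comp (trK (psiKS (ctrOff (d + 1) Lc) Lc))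
      (slotPsiS (ctrOff (d + 1) Lc) Lc (SpureCombOf (symTablesAn1S2 d Lc cΛt) cE cVH cΛ j) κ u)) (psiKS (ctrOff (d + 1) Lc) Lc)) Cs δs := by
  obtain ⟨Cs, δs, hδs, hS⟩ := locStencil_SpureCombOf (symTablesAn1S2 d Lc cΛt) cE cVH cΛ j
  exact locStencil_transportPsiS (Nat.pos_of_ne_zero (NeZero.ne Lc)) (ctrOff_mem_box (Nat.pos_of_ne_zero (NeZero.ne Lc))) hS hδs

/-- [folklore] `𝒯 S′_j` is block-covariant (an2's `SpureCombOf_translate` ⨾ d1-leaf-03's `slotPsiS_shift` ⨾ leaf-01 g84's `conj_psiKS_shiftK`). -/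
theorem transportS_translate (cΛt cE cVH cΛ : ℝ) (j : ℕ) (κ : Fin (d + 1)) (u t : Site (d + 1)) :
    comp (comp (trK (psiKS (ctrOff (d + 1) Lc) Lc)) (slotPsiS (ctrOff (d + 1) Lc) Lc (SpureCombOf (symTablesAn1S2 d Lc cΛt) cE cVH cΛ j) κ (u + (Lc : ℤ) • t))) (psiKS (ctrOff (d + 1) Lc) Lc)
      = shiftK (-((Lc : ℤ) • t)) (comp (comp (trK (psiKS (ctrOff (d + 1) Lc) Lc)) (slotPsiS (ctrOff (d + 1) Lc) Lc (SpureCombOf (symTablesAn1S2 d Lc cΛt) cE cVH cΛ j) κ u))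
          (psiKS (ctrOff (d + 1) Lc) Lc)) := by
  rw [slotPsiS_shift (Nat.pos_of_ne_zero (NeZero.ne Lc)) (ctrOff (d + 1) Lc) (fun κ u t => SpureCombOf_translate (symTablesAn1S2 d Lc cΛt) cE cVH cΛ j κ u t) κ u t, conj_psiKS_shiftK (ctrOff (d + 1) Lc) (Nat.pos_of_ne_zero (NeZero.ne Lc))]

/-- [folklore] **`𝒯 S′_j` HAS PARITY-ODD ROWS** — an1's record parities (`trK_symVhSAt ∕ trK_symHessFFAt`) through an2's slot-generic `trK_SpureRecOf` (the OWNER's `trK_SpureCombOf`), kept by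
the slot transport (leaf-01 g79's `parityOdd_slotPsiS`) and by the leg congruence (road-P2's `parityOdd_conj_psiKS`). -/
theorem parityOdd_transportS (cΛt cE cVH cΛ : ℝ) (j : ℕ) (κ : Fin (d + 1)) (u : Site (d + 1)) :
    trK (comp (comp (trK (psiKS (ctrOff (d + 1) Lc) Lc)) (slotPsiS (ctrOff (d + 1) Lc) Lc (SpureCombOf (symTablesAn1S2 d Lc cΛt) cE cVH cΛ j) κ u)) (psiKS (ctrOff (d + 1) Lc) Lc))
      = -sgnK (comp (comp (trK (psiKS (ctrOff (d + 1) Lc) Lc)) (slotPsiS (ctrOff (d + 1) Lc) Lc (SpureCombOf (symTablesAn1S2 d Lc cΛt) cE cVH cΛ j) κ u)) (psiKS (ctrOff (d + 1) Lc) Lc)) := by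
  have hp : ∀ (κ : Fin (d + 1)) (u : Site (d + 1)), trK (SpureCombOf (symTablesAn1S2 d Lc cΛt) cE cVH cΛ j κ u) = -sgnK (SpureCombOf (symTablesAn1S2 d Lc cΛt) cE cVH cΛ j κ u) :=
    fun κ u => trK_SpureCombOf (symTablesAn1S2 d Lc cΛt) (fun κ u => trK_symVhSAt (ctr (d + 1) Lc) Lc κ u) (fun μ y => trK_symHessFFAt (ctr (d + 1) Lc) Lc μ y) cE cVH cΛ j κ u
  obtain ⟨Cs, δs, hδs, hS⟩ := locStencil_SpureCombOf (symTablesAn1S2 d Lc cΛt) cE cVH cΛ j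
  have hT := locStencil_slotPsiS (d := d) (Nat.pos_of_ne_zero (NeZero.ne Lc)) (ctrOff (d + 1) Lc) hS hδs.le
  have hX : Loc (slotPsiS (ctrOff (d + 1) Lc) Lc (SpureCombOf (symTablesAn1S2 d Lc cΛt) cE cVH cΛ j) κ u) := ⟨u, u, _, _, hδs, hT κ u⟩
  exact parityOdd_conj_psiKS (spr_psiKS (Nat.pos_of_ne_zero (NeZero.ne Lc)) (ctrOff_mem_box (Nat.pos_of_ne_zero (NeZero.ne Lc)))) hX (parityOdd_slotPsiS (ctrOff (d + 1) Lc) Lc _ hp κ u)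

/-- [folklore] `T♮_j = unitS s_f s_m (𝒯 S′_j)` is a local stencil family. -/
theorem exists_locStencil_unitS_transportS (sf sm cΛt cE cVH cΛ : ℝ) (j : ℕ) :
    ∃ Cs δs : ℝ, 0 < δs ∧ LocStencil (unitS sf sm (fun κ u => comp (comp (trK (psiKS (ctrOff (d + 1) Lc) Lc))
      (slotPsiS (ctrOff (d + 1) Lc) Lc (SpureCombOf (symTablesAn1S2 d Lc cΛt) cE cVH cΛ j) κ u)) (psiKS (ctrOff (d + 1) Lc) Lc))) Cs δs := by
  obtain ⟨Cs, δs, hδs, hS⟩ := exists_locStencil_transportS (d := d) (Lc := Lc) cΛt cE cVH cΛ j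
  exact ⟨_, δs, hδs, locStencil_unitS hS⟩

/-- [folklore] `T♮_j` is block-covariant (leaf-04's `unitS_translate_block`). -/
theorem unitS_transportS_translate (sf sm cΛt cE cVH cΛ : ℝ) (j : ℕ) (κ : Fin (d + 1)) (u t : Site (d + 1)) :
    unitS sf sm (fun κ u => comp (comp (trK (psiKS (ctrOff (d + 1) Lc) Lc)) (slotPsiS (ctrOff (d + 1) Lc) Lc (SpureCombOf (symTablesAn1S2 d Lc cΛt) cE cVH cΛ j) κ u))
        (psiKS (ctrOff (d + 1) Lc) Lc)) κ (u + (Lc : ℤ) • t)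
      = shiftK (-((Lc : ℤ) • t)) (unitS sf sm (fun κ u => comp (comp (trK (psiKS (ctrOff (d + 1) Lc) Lc))
          (slotPsiS (ctrOff (d + 1) Lc) Lc (SpureCombOf (symTablesAn1S2 d Lc cΛt) cE cVH cΛ j) κ u)) (psiKS (ctrOff (d + 1) Lc) Lc)) κ u) :=
  unitS_translate_block (Lc := Lc) sf sm (fun κ u t => transportS_translate (d := d) (Lc := Lc) cΛt cE cVH cΛ j κ u t) κ u t

/-! ## §2 The (A)-tower junction at the comb data: the symmetrised exit-face source of `T♮_j` vanishes at every first leg -/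

/-- NOT IN PRINT; OUR BOOKKEEPING ([folklore]; leaf-04 g69's `faceSource_unitS_SpureRecAt_add_swap_eq_zero` with `S♮_j ↦ T♮_j`).  For every `(s, f)`, every constant `K`:
`Σ'_{s′} [s′_ν face]·K·Σ'_{t′} [t′_μ face]·T♮_j μ t′ s s′ f (inl ν) + Σ'_{s′} [s′_μ face]·K·Σ'_{t′} [t′_ν face]·T♮_j ν t′ s s′ f (inl μ) = 0` — the face indicator as the class datum
`Lc⁻¹ + (Φ(n+1) − Φ(n))`, `Φ(n) = −Lc⁻¹·(n mod Lc)`, then leaf-01 g84's `sym_transport_SpureCombOf_an1S2` (weighted leg first) moved to the free-leg-first placement with units by §1's parity. -/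
theorem faceSource_unitS_transportS_add_swap_eq_zero (sf sm cΛt cE cVH cΛ K : ℝ) (j : ℕ) (μ ν : Fin (d + 1)) (s : Site (d + 1)) (f : Fib d) :
    (∑' s' : Site (d + 1), (if s' ν % (Lc : ℤ) = (Lc : ℤ) - 1 then
        K * ∑' t' : Site (d + 1), (if t' μ % (Lc : ℤ) = (Lc : ℤ) - 1 then
          unitS sf sm (fun κ u => comp (comp (trK (psiKS (ctrOff (d + 1) Lc) Lc)) (slotPsiS (ctrOff (d + 1) Lc) Lc (SpureCombOf (symTablesAn1S2 d Lc cΛt) cE cVH cΛ j) κ u))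
            (psiKS (ctrOff (d + 1) Lc) Lc)) μ t' s s' f (Sum.inl ν) else 0) else 0)) +
      ∑' s' : Site (d + 1), (if s' μ % (Lc : ℤ) = (Lc : ℤ) - 1 then
        K * ∑' t' : Site (d + 1), (if t' ν % (Lc : ℤ) = (Lc : ℤ) - 1 then
          unitS sf sm (fun κ u => comp (comp (trK (psiKS (ctrOff (d + 1) Lc) Lc)) (slotPsiS (ctrOff (d + 1) Lc) Lc (SpureCombOf (symTablesAn1S2 d Lc cΛt) cE cVH cΛ j) κ u))
            (psiKS (ctrOff (d + 1) Lc) Lc)) ν t' s s' f (Sum.inl μ) else 0) else 0) = 0 := by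
  have hLc : 1 ≤ Lc := Nat.one_le_iff_ne_zero.mpr (NeZero.ne Lc)
  have hL0 : (Lc : ℝ) ≠ 0 := by exact_mod_cast NeZero.ne Lc
  set T : Fin (d + 1) → Site (d + 1) → MKer (d + 1) (Fib d) := fun κ u => comp (comp (trK (psiKS (ctrOff (d + 1) Lc) Lc))
    (slotPsiS (ctrOff (d + 1) Lc) Lc (SpureCombOf (symTablesAn1S2 d Lc cΛt) cE cVH cΛ j) κ u)) (psiKS (ctrOff (d + 1) Lc) Lc) with hTdef
  -- the face indicator is a face-supported class datum: `𝟙[n ≡ −1] = Lc⁻¹ + (Φ(n+1) − Φ(n))`, `Φ(n) = −Lc⁻¹·(n mod Lc)`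
  set Φ : ℤ → ℝ := fun n => -((Lc : ℝ)⁻¹) * (((n % (Lc : ℤ) : ℤ) : ℝ)) with hΦ
  have hface : ∀ n : ℤ, (if n % (Lc : ℤ) = (Lc : ℤ) - 1 then (1 : ℝ) else 0) = (Lc : ℝ)⁻¹ + (Φ (n + 1) - Φ n) := by
    intro n
    have hs := FaceDatumMultiplierResponse.sawtooth_step (Lc := Lc) hLc n
    have e : (Lc : ℝ)⁻¹ + (Φ (n + 1) - Φ n) = (Lc : ℝ)⁻¹ * (1 - (((((n + 1) % (Lc : ℤ) : ℤ) : ℝ)) - (((n % (Lc : ℤ) : ℤ) : ℝ)))) := by simp only [hΦ]; ring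
    rw [e, hs]
    field_simp
    ring
  have hΦb : ∀ n, |Φ n| ≤ 1 := by
    intro n
    have hL : (0 : ℤ) < Lc := by exact_mod_cast hLc
    have hLr : (0 : ℝ) < Lc := by exact_mod_cast hL
    have hm0 : (0 : ℝ) ≤ (((n % (Lc : ℤ) : ℤ) : ℝ)) := by exact_mod_cast Int.emod_nonneg _ hL.ne'
    have hm1 : (((n % (Lc : ℤ) : ℤ) : ℝ)) ≤ (Lc : ℝ) := by exact_mod_cast (Int.emod_lt_of_pos n hL).le
    simp only [hΦ]
    rw [abs_mul, abs_neg, abs_inv, abs_of_pos hLr, abs_of_nonneg hm0]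
    calc (Lc : ℝ)⁻¹ * (((n % (Lc : ℤ) : ℤ) : ℝ)) ≤ (Lc : ℝ)⁻¹ * (Lc : ℝ) := mul_le_mul_of_nonneg_left hm1 (by positivity)
      _ = 1 := by field_simp
  have hff : ∀ n : ℤ, n % (Lc : ℤ) ≠ (Lc : ℤ) - 1 → (Lc : ℝ)⁻¹ + (Φ (n + 1) - Φ n) = 0 := fun n hn => by rw [← hface n, if_neg hn]
  -- leaf-01 g84's transported current symmetry, weighted leg first, free leg `(s, f)` second
  have hT := sym_transport_SpureCombOf_an1S2 (d := d) (Lc := Lc) cΛt cE cVH cΛ j μ ν ((Lc : ℝ)⁻¹) Φ 1 hΦb hff ((Lc : ℝ)⁻¹) Φ 1 hΦb hff s f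
  -- move to the free-leg-first placement with units: every entry picks up the same factor `−(sf·sm)⁻¹·ℓ(f)·sf⁻¹·sgnF f` (§1's parity)
  have hpar : ∀ κ t', trK (T κ t') = -sgnK (T κ t') := fun κ t' => parityOdd_transportS (d := d) (Lc := Lc) cΛt cE cVH cΛ j κ t'
  have eentry : ∀ (κ τ : Fin (d + 1)) (t' s' : Site (d + 1)), unitS sf sm T κ t' s s' f (Sum.inl τ) =
      (-((sf * sm)⁻¹ * legScale sf⁻¹ sm⁻¹ f * sf⁻¹ * sgnF f)) * T κ t' s' s (Sum.inl τ) f := by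
    intro κ τ t' s'
    rw [unitS_apply, legScale_inl]
    have h := congrFun (congrFun (congrFun (congrFun (hpar κ t') s') s) (Sum.inl τ)) f
    rw [trK_apply] at h
    rw [h]
    simp only [Pi.neg_apply, sgnK_apply, sgnF_inl, one_mul]
    ring
  have eterm : ∀ (κ τ : Fin (d + 1)), (∑' s' : Site (d + 1), (if s' τ % (Lc : ℤ) = (Lc : ℤ) - 1 then
        K * ∑' t' : Site (d + 1), (if t' κ % (Lc : ℤ) = (Lc : ℤ) - 1 then unitS sf sm T κ t' s s' f (Sum.inl τ) else 0) else 0)) =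
      (K * -((sf * sm)⁻¹ * legScale sf⁻¹ sm⁻¹ f * sf⁻¹ * sgnF f)) *
        ∑' s' : Site (d + 1), ((Lc : ℝ)⁻¹ + (Φ (s' τ + 1) - Φ (s' τ))) * ∑' t' : Site (d + 1), ((Lc : ℝ)⁻¹ + (Φ (t' κ + 1) - Φ (t' κ))) *
          T κ t' s' s (Sum.inl τ) f := by
    intro κ τ
    rw [← tsum_mul_left]
    refine tsum_congr fun s' => ?_
    rw [← hface (s' τ)]
    have ein : ∑' t' : Site (d + 1), (if t' κ % (Lc : ℤ) = (Lc : ℤ) - 1 then unitS sf sm T κ t' s s' f (Sum.inl τ) else 0) =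
        -((sf * sm)⁻¹ * legScale sf⁻¹ sm⁻¹ f * sf⁻¹ * sgnF f) * ∑' t' : Site (d + 1), ((Lc : ℝ)⁻¹ + (Φ (t' κ + 1) - Φ (t' κ))) * T κ t' s' s (Sum.inl τ) f := by
      rw [← tsum_mul_left]
      refine tsum_congr fun t' => ?_
      rw [← hface (t' κ)]
      by_cases hc : t' κ % (Lc : ℤ) = (Lc : ℤ) - 1
      · rw [if_pos hc, if_pos hc, eentry, one_mul]
      · rw [if_neg hc, if_neg hc, zero_mul, mul_zero]
    rw [ein]
    split_ifs <;> ring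
  rw [eterm μ ν, eterm ν μ, ← mul_add, hT, mul_zero]

/-! ## §3 The symmetrised column charges of the gauge-differentiated inverse vanish -/

/-- NOT IN PRINT; OUR BOOKKEEPING ([folklore]; leaf-04 g69's `respCharge_add_swap_eq_zero` with `S♮_j ↦ T♮_j`, root `ρ_c`).  `chg^{𝒦_μ}_ν(g,t) + chg^{𝒦_ν}_μ(g,t) = 0` for every row `(t, g)`. -/
theorem respCharge_transportS_add_swap_eq_zero (sf sm cΛt cE cVH cΛ : ℝ) (j : ℕ) (μ ν : Fin (d + 1)) (t : Site (d + 1)) (g : Fib d) :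
    (-(∑' s' : Site (d + 1), ∑ b : Fib d,
        comp (unitK sf sm (coDressKBmAt (toSite (ctrOff (d + 1) Lc)) Lc (KInvStep (d := d) Lc j)))
          (fun x z a b => ((Lc : ℝ) * (sm * sf)) * ((((Lc ^ (j + 1) : ℕ) : ℝ)) ^ (d + 1 + 1))⁻¹ *
            ∑' t : Site (d + 1), (if t μ % (Lc : ℤ) = (Lc : ℤ) - 1 then
              unitS sf sm (fun κ u => comp (comp (trK (psiKS (ctrOff (d + 1) Lc) Lc)) (slotPsiS (ctrOff (d + 1) Lc) Lc (SpureCombOf (symTablesAn1S2 d Lc cΛt) cE cVH cΛ j) κ u))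
                (psiKS (ctrOff (d + 1) Lc) Lc)) μ t x z a b else 0)) t s' g b *
          Sum.elim (fun a : Fin (d + 1) => if s' a % (Lc : ℤ) = (Lc : ℤ) - 1 then ((Lc : ℝ) * (sm * sf)) *
            (if a = ν then ((((Lc ^ (j + 1) : ℕ) : ℝ)) ^ (d + 1 + 1))⁻¹ else 0) else 0) (fun _ => (0 : ℝ)) b)) +
      -(∑' s' : Site (d + 1), ∑ b : Fib d,
        comp (unitK sf sm (coDressKBmAt (toSite (ctrOff (d + 1) Lc)) Lc (KInvStep (d := d) Lc j)))
          (fun x z a b => ((Lc : ℝ) * (sm * sf)) * ((((Lc ^ (j + 1) : ℕ) : ℝ)) ^ (d + 1 + 1))⁻¹ *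
            ∑' t : Site (d + 1), (if t ν % (Lc : ℤ) = (Lc : ℤ) - 1 then
              unitS sf sm (fun κ u => comp (comp (trK (psiKS (ctrOff (d + 1) Lc) Lc)) (slotPsiS (ctrOff (d + 1) Lc) Lc (SpureCombOf (symTablesAn1S2 d Lc cΛt) cE cVH cΛ j) κ u))
                (psiKS (ctrOff (d + 1) Lc) Lc)) ν t x z a b else 0)) t s' g b *
          Sum.elim (fun a : Fin (d + 1) => if s' a % (Lc : ℤ) = (Lc : ℤ) - 1 then ((Lc : ℝ) * (sm * sf)) *
            (if a = μ then ((((Lc ^ (j + 1) : ℕ) : ℝ)) ^ (d + 1 + 1))⁻¹ else 0) else 0) (fun _ => (0 : ℝ)) b) = 0 := by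
  classical
  have hLc : 1 ≤ Lc := Nat.one_le_iff_ne_zero.mpr (NeZero.ne Lc)
  have hr : ctrOff (d + 1) Lc ∈ box (d + 1) Lc := ctrOff_mem_box (Nat.pos_of_ne_zero (NeZero.ne Lc))
  set T : Fin (d + 1) → Site (d + 1) → MKer (d + 1) (Fib d) := fun κ u => comp (comp (trK (psiKS (ctrOff (d + 1) Lc) Lc))
    (slotPsiS (ctrOff (d + 1) Lc) Lc (SpureCombOf (symTablesAn1S2 d Lc cΛt) cE cVH cΛ j) κ u)) (psiKS (ctrOff (d + 1) Lc) Lc) with hTdef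
  obtain ⟨Cs₀, δs₀, hδs₀, hS₀⟩ := exists_locStencil_transportS (d := d) (Lc := Lc) cΛt cE cVH cΛ j
  have hS : LocStencil (unitS sf sm T) _ δs₀ := locStencil_unitS (sf := sf) (sm := sm) hS₀
  rw [respCharge_eq hLc hr sf sm j hS hδs₀ μ ν t g, respCharge_eq hLc hr sf sm j hS hδs₀ ν μ t g, ← neg_add, ← mul_add, neg_eq_zero]
  -- summability of the two `s`-families (decaying kernel × bounded source), as in 39
  obtain ⟨δ, C, hδ, hC, hXd⟩ := decays_coDressKBmAt hLc hr (decays_KInvStep (d := d) (Lc := Lc) j)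
  have hXu := decays_unitK (sf := sf) (sm := sm) hXd
  have hsum : ∀ (κ τ : Fin (d + 1)), Summable fun s : Site (d + 1) => ∑ f : Fib d, unitK sf sm (coDressKBmAt (toSite (ctrOff (d + 1) Lc)) Lc (KInvStep (d := d) Lc j)) t s g f *
      ∑' s' : Site (d + 1), (if s' τ % (Lc : ℤ) = (Lc : ℤ) - 1 then
        (((Lc : ℝ) * (sm * sf)) * ((((Lc ^ (j + 1) : ℕ) : ℝ)) ^ (d + 1 + 1))⁻¹ *
          ∑' t' : Site (d + 1), (if t' κ % (Lc : ℤ) = (Lc : ℤ) - 1 then unitS sf sm T κ t' s s' f (Sum.inl τ) else 0)) else 0) := by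
    intro κ τ
    obtain ⟨CG, hGκ⟩ : ∃ CG : ℝ, Decays (fun x z a b => ((Lc : ℝ) * (sm * sf)) * ((((Lc ^ (j + 1) : ℕ) : ℝ)) ^ (d + 1 + 1))⁻¹ *
        ∑' t : Site (d + 1), (if t κ % (Lc : ℤ) = (Lc : ℤ) - 1 then unitS sf sm T κ t x z a b else 0)) CG (δs₀ / 2) :=
      ⟨_, RespInnerBondKernel.decays_gaugeStencil (Lc := Lc) hS hδs₀ sf sm j κ⟩
    have hCG : 0 ≤ CG := hGκ.nonneg (Sum.inl 0)
    refine summable_sum fun f _ => ?_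
    refine Summable.of_norm_bounded (((summable_exp_shift hδ t).mul_left (max |sf| |sm| * C * max |sf| |sm|)).mul_right (CG * Zl (d + 1) (δs₀ / 2))) (fun s => ?_)
    rw [Real.norm_eq_abs, abs_mul]
    exact mul_le_mul (hXu t s g f) (abs_faceSource_le Lc hGκ (half_pos hδs₀) τ s f) (abs_nonneg _) (by positivity)
  rw [← (hsum μ ν).tsum_add (hsum ν μ)]
  refine mul_eq_zero_of_right _ ((tsum_congr fun s => ?_).trans tsum_zero)
  rw [← Finset.sum_add_distrib]
  refine Finset.sum_eq_zero fun f _ => ?_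
  rw [← mul_add, faceSource_unitS_transportS_add_swap_eq_zero (d := d) (Lc := Lc) sf sm cΛt cE cVH cΛ _ j μ ν s f, mul_zero]

/-! ## §4 (L3c) at the comb data: the two outer-summed second-response words cancel -/

section Words

variable {M : Fin (d + 1) → Site (d + 1) → MKer (d + 1) (Fib d)} {CM δM : ℝ}

/-- NOT IN PRINT; OUR BOOKKEEPING ([folklore]; (L3c) AT THE COMB DATA — leaf-04 g69's `respWords_add_swap_eq_zero` with `S♮_j ↦ T♮_j`, root `ρ_c = toSite (ctrOff (d+1) Lc)`).  For ANY
multiplier vertex family `M` at a positive rate that is block-covariant, every axis pattern `(μ,ν;α,β)`, every bond `c`, every level `j`, all units and pins: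
`Σ'_{u′} FF[dM (K2OfK X̃_j Lc T♮_j M μ c) Lc T♮_j M ν u′] + Σ'_{u′} FF[dM (K2OfK X̃_j Lc T♮_j M ν c) Lc T♮_j M μ u′] = 0`. -/
theorem respWords_transportS_add_swap_eq_zero (sf sm cΛt cE cVH cΛ : ℝ) (j : ℕ)
    (hM : VertexFamily M Lc CM δM) (hδM : 0 < δM) (hMcov : ∀ (ρ' : Fin (d + 1)) (w t : Site (d + 1)), M ρ' (w + t) = shiftK (-((Lc : ℤ) • t)) (M ρ' w))
    (μ ν α β : Fin (d + 1)) (c : Site (d + 1)) :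
    (∑' u' : Site (d + 1), ∑' yw : Site (d + 1) × Site (d + 1),
        (if yw.1 α % (Lc : ℤ) = (Lc : ℤ) - 1 then (1 : ℝ) else 0) * (if yw.2 β % (Lc : ℤ) = (Lc : ℤ) - 1 then (1 : ℝ) else 0) *
          dM (K2OfK (unitK sf sm (coDressKBmAt (toSite (ctrOff (d + 1) Lc)) Lc (KInvStep (d := d) Lc j))) Lc
              (unitS sf sm (fun κ u => comp (comp (trK (psiKS (ctrOff (d + 1) Lc) Lc)) (slotPsiS (ctrOff (d + 1) Lc) Lc (SpureCombOf (symTablesAn1S2 d Lc cΛt) cE cVH cΛ j) κ u))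
                (psiKS (ctrOff (d + 1) Lc) Lc))) M μ c) Lc
            (unitS sf sm (fun κ u => comp (comp (trK (psiKS (ctrOff (d + 1) Lc) Lc)) (slotPsiS (ctrOff (d + 1) Lc) Lc (SpureCombOf (symTablesAn1S2 d Lc cΛt) cE cVH cΛ j) κ u))
              (psiKS (ctrOff (d + 1) Lc) Lc))) M ν u' yw.1 yw.2 (Sum.inl α) (Sum.inl β)) +
      ∑' u' : Site (d + 1), ∑' yw : Site (d + 1) × Site (d + 1),
        (if yw.1 α % (Lc : ℤ) = (Lc : ℤ) - 1 then (1 : ℝ) else 0) * (if yw.2 β % (Lc : ℤ) = (Lc : ℤ) - 1 then (1 : ℝ) else 0) *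
          dM (K2OfK (unitK sf sm (coDressKBmAt (toSite (ctrOff (d + 1) Lc)) Lc (KInvStep (d := d) Lc j))) Lc
              (unitS sf sm (fun κ u => comp (comp (trK (psiKS (ctrOff (d + 1) Lc) Lc)) (slotPsiS (ctrOff (d + 1) Lc) Lc (SpureCombOf (symTablesAn1S2 d Lc cΛt) cE cVH cΛ j) κ u))
                (psiKS (ctrOff (d + 1) Lc) Lc))) M ν c) Lc
            (unitS sf sm (fun κ u => comp (comp (trK (psiKS (ctrOff (d + 1) Lc) Lc)) (slotPsiS (ctrOff (d + 1) Lc) Lc (SpureCombOf (symTablesAn1S2 d Lc cΛt) cE cVH cΛ j) κ u))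
              (psiKS (ctrOff (d + 1) Lc) Lc))) M μ u' yw.1 yw.2 (Sum.inl α) (Sum.inl β) = 0 := by
  classical
  have hLc : 1 ≤ Lc := Nat.one_le_iff_ne_zero.mpr (NeZero.ne Lc)
  have hr : ctrOff (d + 1) Lc ∈ box (d + 1) Lc := ctrOff_mem_box (Nat.pos_of_ne_zero (NeZero.ne Lc))
  set T : Fin (d + 1) → Site (d + 1) → MKer (d + 1) (Fib d) := fun κ u => comp (comp (trK (psiKS (ctrOff (d + 1) Lc) Lc))
    (slotPsiS (ctrOff (d + 1) Lc) Lc (SpureCombOf (symTablesAn1S2 d Lc cΛt) cE cVH cΛ j) κ u)) (psiKS (ctrOff (d + 1) Lc) Lc) with hTdef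
  obtain ⟨Cs₀, δs₀, hδs₀, hS₀⟩ := exists_locStencil_transportS (d := d) (Lc := Lc) cΛt cE cVH cΛ j
  have hS : LocStencil (unitS sf sm T) _ δs₀ := locStencil_unitS (sf := sf) (sm := sm) hS₀
  have hScov : ∀ (κ : Fin (d + 1)) (u t : Site (d + 1)), unitS sf sm T κ (u + (Lc : ℤ) • t) = shiftK (-((Lc : ℤ) • t)) (unitS sf sm T κ u) :=
    fun κ u t => unitS_transportS_translate (d := d) (Lc := Lc) sf sm cΛt cE cVH cΛ j κ u t
  have h₁ : ∀ y : Site (d + 1), |(if y α % (Lc : ℤ) = (Lc : ℤ) - 1 then (1 : ℝ) else 0)| ≤ 1 := fun y => by split_ifs <;> simp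
  have h₂ : ∀ w : Site (d + 1), |(if w β % (Lc : ℤ) = (Lc : ℤ) - 1 then (1 : ℝ) else 0)| ≤ 1 := fun w => by split_ifs <;> simp
  have hρ₁ : ∀ y s : Site (d + 1), (if (y + (Lc : ℤ) • s) α % (Lc : ℤ) = (Lc : ℤ) - 1 then (1 : ℝ) else 0) = (if y α % (Lc : ℤ) = (Lc : ℤ) - 1 then (1 : ℝ) else 0) :=
    fun y s => face_weight_periodic Lc α y s
  have hρ₂ : ∀ w s : Site (d + 1), (if (w + (Lc : ℤ) • s) β % (Lc : ℤ) = (Lc : ℤ) - 1 then (1 : ℝ) else 0) = (if w β % (Lc : ℤ) = (Lc : ℤ) - 1 then (1 : ℝ) else 0) :=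
    fun w s => face_weight_periodic Lc β w s
  rw [tsum_respWord_eq_cell hLc hr sf sm j hS hδs₀ hScov hM hδM hMcov h₁ h₂ hρ₁ hρ₂ μ ν (Sum.inl α) (Sum.inl β) c,
    tsum_respWord_eq_cell hLc hr sf sm j hS hδs₀ hScov hM hδM hMcov h₁ h₂ hρ₁ hρ₂ ν μ (Sum.inl α) (Sum.inl β) c]
  exact cell_pairing_add_swap_eq_zero' (Lc := Lc)
    (Q₁ := fun g t => -(∑' s' : Site (d + 1), ∑ b : Fib d,
        comp (unitK sf sm (coDressKBmAt (toSite (ctrOff (d + 1) Lc)) Lc (KInvStep (d := d) Lc j)))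
          (fun x z a b => ((Lc : ℝ) * (sm * sf)) * ((((Lc ^ (j + 1) : ℕ) : ℝ)) ^ (d + 1 + 1))⁻¹ *
            ∑' t : Site (d + 1), (if t μ % (Lc : ℤ) = (Lc : ℤ) - 1 then unitS sf sm T μ t x z a b else 0)) t s' g b *
          Sum.elim (fun a : Fin (d + 1) => if s' a % (Lc : ℤ) = (Lc : ℤ) - 1 then ((Lc : ℝ) * (sm * sf)) *
            (if a = ν then ((((Lc ^ (j + 1) : ℕ) : ℝ)) ^ (d + 1 + 1))⁻¹ else 0) else 0) (fun _ => (0 : ℝ)) b))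
    (Q₂ := fun g t => -(∑' s' : Site (d + 1), ∑ b : Fib d,
        comp (unitK sf sm (coDressKBmAt (toSite (ctrOff (d + 1) Lc)) Lc (KInvStep (d := d) Lc j)))
          (fun x z a b => ((Lc : ℝ) * (sm * sf)) * ((((Lc ^ (j + 1) : ℕ) : ℝ)) ^ (d + 1 + 1))⁻¹ *
            ∑' t : Site (d + 1), (if t ν % (Lc : ℤ) = (Lc : ℤ) - 1 then unitS sf sm T ν t x z a b else 0)) t s' g b *
          Sum.elim (fun a : Fin (d + 1) => if s' a % (Lc : ℤ) = (Lc : ℤ) - 1 then ((Lc : ℝ) * (sm * sf)) *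
            (if a = μ then ((((Lc ^ (j + 1) : ℕ) : ℝ)) ^ (d + 1 + 1))⁻¹ else 0) else 0) (fun _ => (0 : ℝ)) b))
    (Φ := fun κ t => ∑' yw : Site (d + 1) × Site (d + 1), (if yw.1 α % (Lc : ℤ) = (Lc : ℤ) - 1 then (1 : ℝ) else 0) * (if yw.2 β % (Lc : ℤ) = (Lc : ℤ) - 1 then (1 : ℝ) else 0) *
        unitS sf sm T κ t yw.1 yw.2 (Sum.inl α) (Sum.inl β))
    (Ψ := fun ρ' => ∑' yw : Site (d + 1) × Site (d + 1), (if yw.1 α % (Lc : ℤ) = (Lc : ℤ) - 1 then (1 : ℝ) else 0) * (if yw.2 β % (Lc : ℤ) = (Lc : ℤ) - 1 then (1 : ℝ) else 0) *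
        M ρ' 0 yw.1 yw.2 (Sum.inl α) (Sum.inl β))
    (fun t g => respCharge_transportS_add_swap_eq_zero (d := d) (Lc := Lc) sf sm cΛt cE cVH cΛ j μ ν t g)

end Words

end Summit.QuantumFields.BalabanUV.Beta.GAN24.CombRespWordsZero

end
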